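import Summits.BirchSwinnertonDyer.BirchSwinnertonDyer.Theses.SignedBaseChange
import HarnessLib

/-!
# K1 `TwistPairGreenbergProductDivisibility` (stmt-BirchSwinnertonDyer-20249, aside since rev 10) follows from
# K1′ `TwistPairGreenbergProductDivisibilitySplit` (stmt-BirchSwinnertonDyer-20502, the deciding crux)
# (route SignedBaseChange; helper `--supports` 20249)

At rev 10 (2026-08-27T08:54Z) the tenure planner restated the deciding crux K1 as K1′: the same
`∃ K …`-package with three splitting conjuncts inserted after `IsCoprime N d_K` — every prime of `N` split in
`K`, every prime of the twist parameter `d` split in `K`, and `2` split in `K` (the Heegner-side input the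
descent item K2R″ consumes) — and the same `∀`-over-frames Greenberg PRODUCT divisibility. K1′ ⇒ K1 by
forgetting the three conjuncts; this file lands that implication against the route decls (the planner's
`Sketch5.k1_of_k1split` was checked against a local copy only), so that the banked aside 20249 closes by
modus ponens the moment 20502 does. Pure logic; no new definitions.
-/

-- D-0017: single-problem summit, the namespace repeats the problem name by design.
set_option linter.dupNamespace false
set_option autoImplicit false

namespace Summit.BirchSwinnertonDyer.BirchSwinnertonDyer.Theorems.SignedBaseChangeK1Glue

open Summit.BirchSwinnertonDyer.BirchSwinnertonDyer.Theses.SignedBaseChange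

/-- **K1′ ⇒ K1**: `TwistPairGreenbergProductDivisibilitySplit → TwistPairGreenbergProductDivisibility` — drop
the three splitting conjuncts (`ℓ ∣ N` split, `ℓ ∣ d` split, `2` split) from K1′'s package; everything else,
including the `∀`-over-frames product divisibility, is VERBATIM the same. -/
theorem twistPairGreenbergProductDivisibility_of_split
    (h : TwistPairGreenbergProductDivisibilitySplit) : TwistPairGreenbergProductDivisibility := by
  intro hmodP W _ _ p _ hp5 hX hs
  obtain ⟨K, iF, iNF, ι, v, vbar, κ₁, κ₂, γ₁, γ₂, iPair, iD, N, iN, f, d, W', iE', iM', C, N', iN', f',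
    h0, h1, h2, h3, h4, h5, h6, h7, h8, h9, h10, h11, h12, h13, h14, -, -, -, h15, h16, h17, hall⟩ :=
    h hmodP W p hp5 hX hs
  exact ⟨K, iF, iNF, ι, v, vbar, κ₁, κ₂, γ₁, γ₂, iPair, iD, N, iN, f, d, W', iE', iM', C, N', iN', f',
    h0, h1, h2, h3, h4, h5, h6, h7, h8, h9, h10, h11, h12, h13, h14, h15, h16, h17, hall⟩

end Summit.BirchSwinnertonDyer.BirchSwinnertonDyer.Theorems.SignedBaseChangeK1Glue
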